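import Literature.AlgebraicGeometry.Motives.FormToFunctionFieldBaseChange
import Literature.AlgebraicGeometry.Motives.ProjectiveSpaceGeometricallyIntegral
import Literature.AlgebraicGeometry.Motives.GenericFibreRatSpread
import Literature.AlgebraicGeometry.Motives.RuledSurfaceRelation
import Literature.AlgebraicGeometry.Motives.CartierDivisorIntersectionCycle
import Literature.AlgebraicGeometry.Motives.HypersurfaceLinearSections
import Mathlib.AlgebraicGeometry.PullbackCarrier
import HarnessLib

/-!
# Intersecting a family of subvarieties of `ℙᴺ` with a hypersurface: the horizontal multiplicities are those of the generic fibre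

Fulton, *Intersection Theory*, Example 2.3 / §1.7 and Bloch, *Lectures on Algebraic Cycles*,
Lemma 1A.1 (proof: "`(X_K)^m = lim_U (X ×_k U)^m`" — the points of codimension `m` of the generic
fibre are those of the total space over the generic point, WITH THE SAME LOCAL RINGS). For an
integral `k`-scheme `B` locally of finite type with function field `K = k(B)`, the generic fibre
`ι : ℙᴺ_K → ℙᴺ ×ₖ B` (`genericFibreι`, `Motives/RuledSurfaceRelation`) is a flat preimmersion, so
its stalk maps are isomorphisms (`Motives/GenericFibreRatSpread`). Consequently, for a form `G` over
`k` of degree `e ≥ 1`, the hypersurface `V₊(G) ⊆ ℙᴺ_k` pulled back to `ℙᴺ ×ₖ B` along `pr₁`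
(`ProjFamily.pullbackFormDivisor`, a Cartier divisor on the — integral — total space), and a point
`z ∈ ℙᴺ_K` not on `V₊(G ⊗ 1)` with a codimension-one specialisation `z ⤳ q`:

* `ProjFamily.primeInter_pullbackFormDivisor_genericFibreι` — **the coefficient of `[closure {ι q}]`
  in the intersection cycle `pr₁^*V₊(G) · [closure {ι z}]` on `ℙᴺ ×ₖ B` equals the coefficient of
  `[closure {q}]` in `V₊(G ⊗ 1) · [closure {z}]` on the generic fibre `ℙᴺ_K`** (Fulton's
  `D · [V]`, `CartierDivisor.primeInter` of `Motives/CartierDivisorIntersectionCycle`). Proof: both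
  coefficients are `ord_{A/𝔭}(t̄)` for `A` the local ring at the point, `𝔭` the prime of the
  subvariety and `t` a local equation (`ordAt_pullbackAvoiding_ofPoint_eq_toNat_ord_quotient`,
  Fulton Thm. 2.4, Case 1 of the proof); the stalk isomorphism `𝒪_{ℙ×B, ι q} ≅ 𝒪_{ℙ_K, q}` matches the
  primes (naturality of specialisation maps) and the local equations (`F/x_lᵉ` pulls back to
  `(F ⊗ 1)/x_lᵉ`, `Motives/FormToFunctionFieldBaseChange`), and `Ring.ord` is invariant under
  ring isomorphisms.

Also: `pr₁ ∘ ι` is the base-change morphism `ℙᴺ_K → ℙᴺ_k` on points (`fst_genericFibreι_apply`),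
`G ∈ 𝔭_{pr₁ (ι q)} ↔ G ⊗ 1 ∈ 𝔭_q` (`mem_asHomogeneousIdeal_projMap_iff`), `pr₁` is dominant,
`ι` is flat, and `dim closure {ι p} = dim B + dim closure {p}` (`height_genericFibreι_apply`).

Everything is proved; no named facts.

## References

* [Fulton1998] W. Fulton, Intersection Theory, 2nd ed. (1998), Def. 2.3, Thm. 2.4 (Case 1 of the
  proof, p. 36), §1.7.
* [BlochLectures2010] S. Bloch, Lectures on Algebraic Cycles, 2nd ed. (2010), Lemma 1A.1 (proof).
-/

noncomputable section

open CategoryTheory CategoryTheory.Limits AlgebraicGeometry Order MonoidalCategory IsLocalRing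
  TopologicalSpace
open MvPolynomial (X C)
open Literature.AlgebraicGeometry.Motives.Segre Literature.AlgebraicGeometry.Motives.RatFn

universe u

namespace Literature.AlgebraicGeometry.Motives

attribute [local instance] MvPolynomial.gradedAlgebra

namespace ProjFamily

open ProjBaseChangeRing ProjSpace

variable {k : Type u} [Field k] (N : ℕ) (B : SchemeOver k) [IsIntegral B.left]

/-! ### `pr₁ : ℙᴺ ×ₖ B → ℙᴺ`, the generic fibre, and base change on points -/

/-- A `k`-scheme which is nonempty maps ONTO `Spec k`. [folklore] -/
instance surjective_hom : Surjective B.hom :=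
  ⟨fun _ => ⟨genericPoint B.left, Subsingleton.elim _ _⟩⟩

/-- `pr₁ : ℙᴺ ×ₖ B → ℙᴺ` is surjective (base change of `B → Spec k`). [folklore] -/
instance surjective_fst_left :
    Surjective (CartesianMonoidalCategory.fst (projectiveSpace N k) B).left :=
  MorphismProperty.pullback_fst (P := @Surjective) (projectiveSpace N k).hom B.hom inferInstance

/-- The generic fibre `ι : ℙᴺ_K → ℙᴺ ×ₖ B` is flat (base change of `Spec K → B`). [folklore] -/
instance flat_genericFibreι : Flat (genericFibreι N B) :=
  MorphismProperty.of_isPullback (isPullback_genericFibreι N B).flip inferInstance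

/-- **`pr₁ (ι p) = π (p)`** for the base-change morphism `π : ℙᴺ_K → ℙᴺ_k`. [folklore] -/
theorem fst_genericFibreι_apply (p : ↥(projectiveSpace N B.left.functionField).left) :
    (CartesianMonoidalCategory.fst (projectiveSpace N k) B).left (genericFibreι N B p) =
      projMap (d := N) k B.left.functionField p := by
  rw [← Scheme.Hom.comp_apply, genericFibreι_fst]
  rfl

omit [IsIntegral B.left] in
/-- **`G ∈ 𝔭_{π p} ↔ G ⊗ 1 ∈ 𝔭_p`** for the base-change morphism `π : ℙᴺ_K → ℙᴺ_k` (its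
underlying map is `𝔭 ↦ 𝔭 ∩ k[x]`). [folklore] -/
theorem mem_asHomogeneousIdeal_projMap_iff {K : Type u} [Field K] [Algebra k K]
    (G : MvPolynomial (Fin (N + 1)) k) (p : ↥(projectiveSpace N K).left) :
    G ∈ ProjectiveSpectrum.asHomogeneousIdeal
        (𝒜 := MvPolynomial.homogeneousSubmodule (Fin (N + 1)) k) (projMap (d := N) k K p) ↔
      MvPolynomial.map (algebraMap k K) G ∈ ProjectiveSpectrum.asHomogeneousIdeal
        (𝒜 := MvPolynomial.homogeneousSubmodule (Fin (N + 1)) K) p :=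
  Iff.rfl

variable [LocallyOfFiniteType B.hom]

/-- `ℙᴺ ×ₖ B → Spec k` is locally of finite type (for `B` locally of finite type). [folklore] -/
instance locallyOfFiniteType_tensor_hom : LocallyOfFiniteType ((projectiveSpace N k) ⊗ B).hom :=
  inferInstanceAs (LocallyOfFiniteType
    (pullback.fst (projectiveSpace N k).hom B.hom ≫ (projectiveSpace N k).hom))

/-- **`pr₁` maps the generic point of `ℙᴺ ×ₖ B` to the generic point of `ℙᴺ`** (it is surjective).
[folklore] -/
theorem fst_genericPoint_eq :
    (CartesianMonoidalCategory.fst (projectiveSpace N k) B).left (genericPoint ↥((projectiveSpace N k) ⊗ B).left) =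
      genericPoint ↥(projectiveSpace N k).left := by
  apply IsGenericPoint.eq _ (genericPoint_spec _)
  have h := (genericPoint_spec ↥((projectiveSpace N k) ⊗ B).left).image
    (CartesianMonoidalCategory.fst (projectiveSpace N k) B).left.continuous
  rwa [Set.image_univ, (surjective_fst_left N B).surj.denseRange.closure_range] at h

/-- **`dim closure {ι p} = dim B + dim closure {p}`**: heights of points of the generic fibre shift by
the dimension of the base (dimension formula, Stacks 02JW, through `dim_image_eq`).
[cite: BlochLectures2010, Lemma 1A.1] -/
theorem height_genericFibreι_apply {e : ℕ} (he : height (genericPoint B.left) = e)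
    (p : ↥(projectiveSpace N B.left.functionField).left) :
    height (genericFibreι N B p) = e + height p := by
  haveI : IsPreimmersion (genericFibreι N B) := inferInstance
  let V : ClosedSubvariety (projectiveSpace N B.left.functionField).left :=
    ClosedSubvariety.ofPoint _ p
  have h := dim_image_eq (X := projectiveSpace N k) (isPullback_genericFibreι N B) (range_qgen B) he V
  have h1 : (V.image (genericFibreι N B)).dim = height (genericFibreι N B p) := by
    change height (V.image (genericFibreι N B)).genericPoint = _
    rw [ClosedSubvariety.genericPoint_image]
    change height (genericFibreι N B (V.ι (genericPoint V.carrier))) = _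
    congr 2
    exact ClosedSubvariety.genericPoint_ofPoint p
  have h2 : V.dim = height p := by
    change height V.genericPoint = _
    congr 1
    exact ClosedSubvariety.genericPoint_ofPoint p
  rw [← h1, h, h2]

/-! ### The pulled-back hypersurface `pr₁^* V₊(G)` on `ℙᴺ ×ₖ B` -/

section Divisor

variable {N B}
variable {e : ℕ} {G : MvPolynomial (Fin (N + 1)) k} (hG : G ∈ grading (Fin (N + 1)) k e)
  (hG0 : G ≠ 0)

/-- `V₊(G)` avoids `pr₁` of the generic point of `ℙᴺ ×ₖ B` (`pr₁` is dominant). [folklore] -/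
theorem formDivisor_avoids_fst_genericPoint :
    (formDivisor G hG hG0).Avoids ((CartesianMonoidalCategory.fst (projectiveSpace N k) B).left
      (genericPoint ↥((projectiveSpace N k) ⊗ B).left)) := by
  rw [fst_genericPoint_eq N B]
  exact CartierDivisor.avoids_genericPoint _

/-- **`pr₁^* V₊(G)`**: the hypersurface `V₊(G) ⊆ ℙᴺ_k` pulled back to the (integral) total space
`ℙᴺ ×ₖ B` along the dominant projection (`CartierDivisor.pullbackAvoiding`; local equations
`pr₁^*(G/x_lᵉ)`). [cite: Fulton1998, Def. 2.3] -/
abbrev pullbackFormDivisor : CartierDivisor ((projectiveSpace N k) ⊗ B).left :=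
  (formDivisor G hG hG0).pullbackAvoiding (CartesianMonoidalCategory.fst (projectiveSpace N k) B).left
    (formDivisor_avoids_fst_genericPoint hG hG0)

/-- `pr₁^* V₊(G)` avoids `w` iff `G ∉ 𝔭_{pr₁ w}` (`e ≥ 1`). [folklore] -/
theorem pullbackFormDivisor_avoids_iff (he : 0 < e) (w : ↥((projectiveSpace N k) ⊗ B).left) :
    (pullbackFormDivisor hG hG0).Avoids w ↔
      G ∉ ProjectiveSpectrum.asHomogeneousIdeal
        (𝒜 := MvPolynomial.homogeneousSubmodule (Fin (N + 1)) k)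
        ((CartesianMonoidalCategory.fst (projectiveSpace N k) B).left w) := by
  rw [← formDivisor_avoids_iff hG hG0 he]
  constructor
  · intro h i hi
    obtain ⟨j, hj⟩ := (pullbackFormDivisor hG hG0).covers w
    have hu := h j hj
    rw [CartierDivisor.pullbackAvoiding_f] at hu
    have hreg : IsRegularAt ((CartesianMonoidalCategory.fst (projectiveSpace N k) B).left w)
        ((formDivisor G hG hG0).f j.1) :=
      isEffective_formDivisor hG hG0 j.1 _ hj
    have key := ((formDivisor G hG hG0).isUnitAt_div i j.1 _ hi hj).mul (hreg.isUnitAt_of_pullbackFn hu)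
    rwa [div_mul_cancel₀ _ ((formDivisor G hG hG0).f_ne_zero j.1)] at key
  · intro h i hi
    rw [CartierDivisor.pullbackAvoiding_f]
    exact (h i.1 hi).pullbackFn

/-- `pr₁^* V₊(G)` avoids `ι z` iff `G ⊗ 1 ∉ 𝔭_z`. [folklore] -/
theorem pullbackFormDivisor_avoids_genericFibreι_iff (he : 0 < e)
    (z : ↥(projectiveSpace N B.left.functionField).left) :
    (pullbackFormDivisor (B := B) hG hG0).Avoids (genericFibreι N B z) ↔
      MvPolynomial.map (algebraMap k B.left.functionField) G ∉ ProjectiveSpectrum.asHomogeneousIdeal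
        (𝒜 := MvPolynomial.homogeneousSubmodule (Fin (N + 1)) B.left.functionField) z := by
  rw [pullbackFormDivisor_avoids_iff hG hG0 he, fst_genericFibreι_apply, mem_asHomogeneousIdeal_projMap_iff]

end Divisor

/-! ### The prime of a subvariety under the stalk isomorphism of the generic fibre -/

section Stalks

variable {N B}

omit [LocallyOfFiniteType B.hom] in
/-- **The stalk isomorphism of the generic fibre matches the primes of corresponding subvarieties**:
for `z ⤳ q` in `ℙᴺ_K` and `φ = ι^♯_q : 𝒪_{ℙ×B, ι q} → 𝒪_{ℙ_K, q}`, the prime `𝔭_{ι z}` of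
`closure {ι z}` at `ι q` is `φ⁻¹` of the prime `𝔭_z` of `closure {z}` at `q` (naturality of the
specialisation maps, and `ι^♯_z` is a local homomorphism). [cite: BlochLectures2010, Lemma 1A.1 (proof)] -/
theorem comap_stalkMap_comap_maximalIdeal {z q : ↥(projectiveSpace N B.left.functionField).left}
    (hzq : z ⤳ q) :
    ((maximalIdeal ((projectiveSpace N B.left.functionField).left.presheaf.stalk z)).comap
        ((projectiveSpace N B.left.functionField).left.presheaf.stalkSpecializes hzq).hom).comap
      ((genericFibreι N B).stalkMap q).hom =
    (maximalIdeal (((projectiveSpace N k) ⊗ B).left.presheaf.stalk (genericFibreι N B z))).comap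
      (((projectiveSpace N k) ⊗ B).left.presheaf.stalkSpecializes
        ((genericFibreι N B).base.hom.map_specializes hzq)).hom := by
  ext s
  simp only [Ideal.mem_comap]
  rw [← Scheme.Hom.stalkSpecializes_stalkMap_apply]
  haveI : IsLocalHom ((genericFibreι N B).stalkMap z).hom := inferInstance
  rw [mem_maximalIdeal, mem_maximalIdeal, mem_nonunits_iff, mem_nonunits_iff,
    isUnit_map_iff]

end Stalks

/-! ### The main statement -/

section Main

variable {N B}
variable {e : ℕ} {G : MvPolynomial (Fin (N + 1)) k} (hG : G ∈ grading (Fin (N + 1)) k e)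
  (hG0 : G ≠ 0)

/-- **Horizontal intersection multiplicities are computed on the generic fibre** (Fulton, Thm. 2.4,
Case 1 of the proof: the coefficient of `[W]` in `D · [V]` is `ℓ_{A/𝔭}(A/(𝔭 + tA))`; Bloch,
Lemma 1A.1: the local rings of `ℙᴺ ×ₖ B` at points over the generic point of `B` are those of the
generic fibre `ℙᴺ_K`). For a form `G` over `k` of degree `e ≥ 1`, a point `z` of `ℙᴺ_K` with
`G ⊗ 1 ∉ 𝔭_z` and a specialisation `z ⤳ q` of codimension one (`dim q + 1 = dim z`), the
coefficient of `[closure {ι q}]` in `pr₁^*V₊(G) · [closure {ι z}]` (a cycle on `ℙᴺ ×ₖ B`) equals the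
coefficient of `[closure {q}]` in `V₊(G ⊗ 1) · [closure {z}]` (a cycle on `ℙᴺ_K`).
[cite: Fulton1998, Theorem 2.4 (Case 1 of the proof, p. 36) and Def. 2.3] [cite: BlochLectures2010, Lemma 1A.1 (proof)] -/
theorem primeInter_pullbackFormDivisor_genericFibreι (he : 0 < e)
    {z q : ↥(projectiveSpace N B.left.functionField).left} (hzq : z ⤳ q)
    (hcodim : height q + 1 = height z)
    (hGz : MvPolynomial.map (algebraMap k B.left.functionField) G ∉
      ProjectiveSpectrum.asHomogeneousIdeal
        (𝒜 := MvPolynomial.homogeneousSubmodule (Fin (N + 1)) B.left.functionField) z) :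
    (pullbackFormDivisor (B := B) hG hG0).primeInter (X := (projectiveSpace N k) ⊗ B)
        (genericFibreι N B z) (genericFibreι N B q) =
      (formDivisor (MvPolynomial.map (algebraMap k B.left.functionField) G)
          ((mapGraded k B.left.functionField (Fin (N + 1))).map_mem hG)
          (by intro h; exact hGz (h ▸ Submodule.zero_mem _))).primeInter
        (X := projectiveSpace N B.left.functionField) z q := by
  classical
  -- notation (no `set` for objects carrying instances)
  let ι := genericFibreι N B
  let fstP := (CartesianMonoidalCategory.fst (projectiveSpace N k) B).left
  have hGK : MvPolynomial.map (algebraMap k B.left.functionField) G ∈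
      grading (Fin (N + 1)) B.left.functionField e :=
    (mapGraded k B.left.functionField (Fin (N + 1))).map_mem hG
  have hGK0 : MvPolynomial.map (algebraMap k B.left.functionField) G ≠ 0 :=
    fun h => hGz (h ▸ Submodule.zero_mem _)
  -- local equations (recorded before abbreviating the divisors)
  have hfs : ∀ j : (pullbackFormDivisor (B := B) hG hG0).ι,
      (pullbackFormDivisor (B := B) hG hG0).f j = pullbackFn fstP (formToFunctionField j.1.1.down.1 G) :=
    fun j => by rw [CartierDivisor.pullbackAvoiding_f, formDivisor_f]; rfl
  have hfK : ∀ p : (formDivisor (MvPolynomial.map (algebraMap k B.left.functionField) G) hGK hGK0).ι,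
      (formDivisor (MvPolynomial.map (algebraMap k B.left.functionField) G) hGK hGK0).f p =
        formToFunctionField p.1.down.1 (MvPolynomial.map (algebraMap k B.left.functionField) G) :=
    formDivisor_f hGK hGK0
  have hUK : ∀ (p : (formDivisor (MvPolynomial.map (algebraMap k B.left.functionField) G) hGK hGK0).ι)
      {y : P N B.left.functionField},
      y ∈ (formDivisor (MvPolynomial.map (algebraMap k B.left.functionField) G) hGK hGK0).U p ↔
        y ∈ U p.1.down.1 :=
    fun p => mem_formDivisor_U_iff hGK hGK0 p
  have hUs : ∀ (j : (pullbackFormDivisor (B := B) hG hG0).ι) {y : ↥((projectiveSpace N k) ⊗ B).left},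
      y ∈ (pullbackFormDivisor (B := B) hG hG0).U j ↔ fstP y ∈ U (d := N) (K := k) j.1.1.down.1 :=
    fun j => mem_formDivisor_U_iff hG hG0 j.1
  set Ds : CartierDivisor ((projectiveSpace N k) ⊗ B).left := pullbackFormDivisor (B := B) hG hG0
    with hDs
  set DK : CartierDivisor (projectiveSpace N B.left.functionField).left :=
    (formDivisor (MvPolynomial.map (algebraMap k B.left.functionField) G) hGK hGK0 :
      CartierDivisor (projectiveSpace N B.left.functionField).left) with hDK
  haveI : IsPreimmersion (genericFibreι N B) := inferInstance
  haveI : IsLocallyNoetherian ((projectiveSpace N k) ⊗ B).left :=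
    LocallyOfFiniteType.isLocallyNoetherian ((projectiveSpace N k) ⊗ B).hom
  haveI : IsLocallyNoetherian (projectiveSpace N B.left.functionField).left :=
    LocallyOfFiniteType.isLocallyNoetherian (projectiveSpace N B.left.functionField).hom
  -- the specialisation upstairs and the heights
  have hw : ι z ⤳ ι q := ι.base.hom.map_specializes hzq
  obtain ⟨b, hb⟩ := ENat.ne_top_iff_exists.mp (height_ne_top_of_locallyOfFiniteType B.hom
    (genericPoint B.left))
  have hcodim' : height (ι q) + 1 = height (ι z) := by
    rw [height_genericFibreι_apply N B hb.symm, height_genericFibreι_apply N B hb.symm, ← hcodim,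
      add_assoc]
  have hvK : coheight (ClosedSubvariety.ofPointPt z hzq) = 1 :=
    (coheight_ofPointPt_eq_one_iff_height (X := projectiveSpace N B.left.functionField) hzq).2 hcodim
  have hvs : coheight (ClosedSubvariety.ofPointPt (ι z) hw) = 1 :=
    (coheight_ofPointPt_eq_one_iff_height (X := (projectiveSpace N k) ⊗ B) hw).2 hcodim'
  -- avoidance at the generic points of the subvarieties
  have havs : Ds.Avoids (ι z) := (pullbackFormDivisor_avoids_genericFibreι_iff hG hG0 he z).2 hGz
  have havK : DK.Avoids z := (formDivisor_avoids_iff hGK hGK0 he).2 hGz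
  have havs' : Ds.Avoids ((ClosedSubvariety.ofPoint ((projectiveSpace N k) ⊗ B).left (ι z)).ι
      (genericPoint (ClosedSubvariety.ofPoint ((projectiveSpace N k) ⊗ B).left (ι z)).carrier)) := by
    change Ds.Avoids (ClosedSubvariety.ofPoint ((projectiveSpace N k) ⊗ B).left (ι z)).genericPoint
    rwa [ClosedSubvariety.genericPoint_ofPoint]
  have havK' : DK.Avoids ((ClosedSubvariety.ofPoint (projectiveSpace N B.left.functionField).left z).ι
      (genericPoint (ClosedSubvariety.ofPoint (projectiveSpace N B.left.functionField).left z).carrier)) := by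
    change DK.Avoids (ClosedSubvariety.ofPoint (projectiveSpace N B.left.functionField).left z).genericPoint
    rwa [ClosedSubvariety.genericPoint_ofPoint]
  -- a chart of `D` containing `pr₁ (ι q)`, its local equation upstairs
  obtain ⟨i, hi⟩ := Ds.covers (ι q)
  set l : Fin (N + 1) := i.1.1.down.1 with hl
  have hreg : IsRegularAt (ι q) (Ds.f i) :=
    ((isEffective_formDivisor hG hG0).pullbackAvoiding fstP (formDivisor_avoids_fst_genericPoint hG hG0))
      i (ι q) hi
  obtain ⟨t, ht⟩ := hreg
  -- the corresponding chart of `DK` contains `q`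
  have hqfst : fstP (ι q) ∈ U (d := N) (K := k) l := (hUs i).1 hi
  have hqU : q ∈ U (d := N) (K := B.left.functionField) l := by
    rw [← projMap_preimage_U (k := k) l]
    change projMap (d := N) k B.left.functionField q ∈ U (d := N) (K := k) l
    rwa [← fst_genericFibreι_apply N B q]
  let iK : DK.ι := (ULift.up ⟨l, genericPoint_mem_U l⟩, PUnit.unit)
  have hiK : q ∈ DK.U iK := (hUK iK).2 hqU
  -- the local equation downstairs is `φ t`
  set φ := ((genericFibreι N B).stalkMap q).hom with hφ
  have hφbij : Function.Bijective φ := stalkMap_bijective_of_flat_of_isPreimmersion (genericFibreι N B) q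
  have htK : toFunctionField q (φ t) = DK.f iK := by
    rw [hφ, ← pullbackFn_toFunctionField, ht, hfs i, hfK iK, ← hl]
    have hregG : IsRegularAt (fstP (ι (genericPoint ↥(projectiveSpace N B.left.functionField).left)))
        (formToFunctionField l G) := by
      change IsRegularAt ((CartesianMonoidalCategory.fst (projectiveSpace N k) B).left
        (genericFibreι N B (genericPoint _))) _
      rw [fst_genericFibreι_apply]
      exact isRegularAt_formToFunctionField l hG (projMap_genericPoint_mem_U l)
    rw [← pullbackFn_comp fstP ι hregG]
    have hcomp : ι ≫ fstP = projMap (d := N) k B.left.functionField := genericFibreι_fst N B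
    rw [hcomp]
    exact pullbackFn_projMap_formToFunctionField (K := B.left.functionField) l hG
  -- the primes
  set 𝔭s := (maximalIdeal (((projectiveSpace N k) ⊗ B).left.presheaf.stalk (ι z))).comap
    (((projectiveSpace N k) ⊗ B).left.presheaf.stalkSpecializes hw).hom with h𝔭s
  set 𝔭K := (maximalIdeal ((projectiveSpace N B.left.functionField).left.presheaf.stalk z)).comap
    ((projectiveSpace N B.left.functionField).left.presheaf.stalkSpecializes hzq).hom with h𝔭K
  have hcomap : 𝔭K.comap φ = 𝔭s := comap_stalkMap_comap_maximalIdeal (N := N) (B := B) hzq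
  -- `t ∉ 𝔭s`, `φ t ∉ 𝔭K`
  have hmemU : ι z ∈ Ds.U i := hw.mem_open (Ds.U i).2 hi
  have htz : t ∉ 𝔭s := by
    rw [h𝔭s, ← isUnitAt_toFunctionField_iff_notMem hw t, ht]
    exact havs i hmemU
  have htzK : φ t ∉ 𝔭K := by
    intro h
    apply htz
    rw [← hcomap, Ideal.mem_comap]
    exact h
  -- both coefficients through Fulton's formula
  rw [CartierDivisor.primeInter_apply_of_specializes _ hw,
    CartierDivisor.primeInter_apply_of_specializes _ hzq,
    CartierDivisor.pullbackRep_of_avoids _ _ havs', CartierDivisor.pullbackRep_of_avoids _ _ havK',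
    CartierDivisor.ordAt_pullbackAvoiding_ofPoint_eq_toNat_ord_quotient hw hi ht havs' hvs htz,
    CartierDivisor.ordAt_pullbackAvoiding_ofPoint_eq_toNat_ord_quotient hzq hiK htK havK' hvK htzK]
  -- the quotients are isomorphic along `φ`
  congr 2
  have hle : 𝔭s ≤ 𝔭K.comap φ := hcomap.ge
  set ψ : ((projectiveSpace N k) ⊗ B).left.presheaf.stalk (ι q) ⧸ 𝔭s →+*
      (projectiveSpace N B.left.functionField).left.presheaf.stalk q ⧸ 𝔭K :=
    Ideal.quotientMap 𝔭K φ hle with hψ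
  have hψbij : Function.Bijective ψ :=
    ⟨Ideal.quotientMap_injective' hcomap.le, Ideal.quotientMap_surjective hφbij.2⟩
  rw [← ChowLocalizationProofs.ringOrd_map_of_bijective ψ hψbij, hψ, Ideal.quotientMap_mk]

end Main

end ProjFamily

end Literature.AlgebraicGeometry.Motives

end
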